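import Summits.CriticalPhenomena.SAWScalingLimit.Theses.SAWLeftRightFKG
import Summits.CriticalPhenomena.SAWScalingLimit.Theorems.LeftRightFKG.Negative.LatticePolylines
import Summits.CriticalPhenomena.SAWScalingLimit.Theorems.BoundaryTP2Negative_Box3

/-!
# Skeleton line `corner-determinant-transfer` for crux `NotFKGAtOne` (stmt-CriticalPhenomena-11233)

Route `SAWLeftRightFKG`, item r9 (auto-crux): `NotFKGAtOne` — left–right positive association FAILS for
the COUNTING measure (fugacity `x = 1`) on the chords of some lattice domain `Ω(C)`, i.e.
`¬ ∀ δ c a b a' b' C …, count A * count B ≤ count univ * count (A ∩ B)` for `≼`-up-closed `A, B`.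
An EXISTENTIAL finite certificate; the standing disproof (`Cruxes/NotFKGAtOne/Disproof.lean`, cycle 1)
says TRUE and names the minimal box witness used here.

## The line (idea `corner-determinant-transfer`, ideator 1; triage r1: 3 × pass "as the corollary stage of
the 3 × 3 box line"; this plan makes the corollary the TRUNK at no extra cost, see `Transfer` below)

WITNESS (shared with every surviving card and with Disproof §3): `δ = 1`, `C = sq3 = ∂[-1,3]²`
(16-step closed lattice walk, counter-clockwise), so `Ω(C) = (-1,3)²` and `Ω(C)_1 = ℤ²[{0,1,2}²]`
(STUB 1, `DomSq3`); chords `a = (0,0) → b = (2,2)` (`a' = (0,-1)`, `b' = (2,3)` on `C`); the two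
corner events `A₃ = {1 ≤ wcross 0 0 γ}` (= first step North) and `B₃ = {1 ≤ wcross 1 1 γ}` (= last step
East), which are `≼`-UP-CLOSED IN EVERY DOMAIN by the landed `wcross_le_of_wind_nonneg`
(`isUp_A₃`, `isUp_B₃`, PROVED below = Disproof §3 verbatim).

LEVER: the kernel-decided census of the 12 chord supports (STUB 2, `ChordEnum`, makes the `pathsFrom`
list a faithful enumeration of `DomainSAW`) sorts them into the four end-step classes with LENGTH
multisets `A∩B = {4,4}`, `Aᶜ∩Bᶜ = {4,4}`, `A∖B = B∖A = {4,6,6,8}` (`corner_census`, `decide`), so for the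
fugacity weight `w_x(γ) = x^{|γ|}` (STUB 3, `CensusAt`: the four weights as `ENNReal.ofReal` of explicit
polynomials, for every `x ≥ 0`)

  `w_x(A₃) w_x(B₃) − w_x(univ) w_x(A₃ ∩ B₃) = (3x⁴+2x⁶+x⁸)² − (6x⁴+4x⁶+2x⁸)(2x⁴)
      = x⁸ (2x² + x⁴ − 1)(3 + 2x² + x⁴)`                                     (`cornerDet₃`, `ring`)

is POSITIVE on the whole ray `2x² + x⁴ > 1`, i.e. `x > (√2 − 1)^{1/2} = 0.6436…` (`cornerDet₃_pos`).
TRANSFER (PROVED here, not a stub): `CensusAt → C⁺` (`cPlus_of_censusAt`) with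
`C⁺ := ∀ x > 0, 2x² + x⁴ > 1 → ¬ LeftRightFKGAt x` (the sibling crux's parametric statement, verbatim
from `Cruxes/LeftRightFKG/Disproof.lean` (a)), and `C⁺ → NotFKGAtOne` at `x = 1` because
`weightAt 1 = Measure.count` is `simp` (`count := sum dirac`; `not_leftRightFKGAt_one_iff`).  So the three
stubs are exactly the three pieces of work the triage panel identified as the residue of EVERY 3 × 3 line
(identification · enumeration bijection · measure evaluation), the order side being already discharged,
and the x-generality costs nothing (`ofReal` of a polynomial instead of a numeral) while landing the
first rung `x ≥ .6436` of the sibling's sorried `not_leftRightFKGAt` (Disproof (a)/E5 of crux 11232).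

`NotFKGAtOne_of` is the kernel-checked composition concluding the crux BY NAME; `sorry` occurs only in
`stub_domSq3`, `stub_chordEnum`, `stub_censusAt`.

## Disproof / negatives used
* `Cruxes/NotFKGAtOne/Disproof.lean` (cycle 1, rev 03:09Z, rc 0, one sorry `counts3x3`): no
  `_false_without_` theorem and no Targets exist (payload `targets = []`); honoured: §1 read-back
  (`dom`, `lr` copied verbatim), §2 `exists_incomparable_of_not_countFKG` /
  `card_fkg_of_distribLattice` (the witness pair lives on the non-staircase classes `{4,6,6,8}` —
  backtracking chords `EENWNE`, `NNESEN`, … are load-bearing), §3 (`sq3`, `A₃`, `B₃`, `le_wcross_of_lr`,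
  `isUp_A₃`, `isUp_B₃` verbatim; its residual `Counts3x3` = our `CensusAt` at `x = 1`), §4 S₁ (no
  witness below 8 vertices — we use 9), S₃ (every fixed witness dies above `x_c`: `C⁺` claims nothing
  for `2x²+x⁴ ≤ 1`, in particular nothing at `x_c ≈ .379` where `2x_c²+x_c⁴ ≈ .308`).
* Landed negatives `Theorems/LeftRightFKG/Negative/*` (boundary adjacency is load-bearing for the
  SIBLING; `wcross` dictionary): `LatticePolylines` imported and USED (`wcross_le_of_wind_nonneg`);
  `BoxDomain`/`BoxMesh` (landed 2026-08-16, the 5 × 4 box) are the template of STUB 1 — import them in the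
  stub proof; no stub is an instance they refute (they refute nothing about `x = 1`).
* `ledger negatives --problem CriticalPhenomena`: none concerns the left–right order or finite counts.
-/

noncomputable section

open scoped ENNReal
open MeasureTheory Set Literature.Probability.LatticeModels Literature.Probability.RandomPlanarGeometry
  Literature.Topology.PlaneTopology
open Summit.CriticalPhenomena.SAWScalingLimit.Theorems.LeftRightFKG.Negative
open Summit.CriticalPhenomena.SAWScalingLimit.Theorems.BoundaryTP2.Negative

namespace Summit.CriticalPhenomena.SAWScalingLimit.Cruxes.NotFKGAtOne.CornerDeterminantTransfer

/-! ### 1. Vocabulary: the fugacity weight, the parametric statement, the crux's objects -/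

/-- The `x^{|γ|}`-weight on the chords of `Ω_δ` from `a` to `b` (sibling `Cruxes/LeftRightFKG/Disproof.lean`
(a), verbatim; the route's `SAW.weight` is `weightAt x_c`, the crux's `Measure.count` is `weightAt 1`). [folklore] -/
def weightAt (x : ℝ) (Ω : Set ℂ) (δ : ℝ) (a b : Site 2) : Measure (SAW.DomainSAW Ω δ a b) :=
  Measure.sum fun γ => ENNReal.ofReal (x ^ γ.length) • Measure.dirac γ

/-- TRANSFER, measure half: at `x = 1` the weight IS Mathlib's counting measure (`count := sum dirac`). [folklore] -/
theorem weightAt_one (Ω : Set ℂ) (δ : ℝ) (a b : Site 2) : weightAt 1 Ω δ a b = Measure.count := by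
  simp [weightAt, Measure.count]

/-- `LeftRightFKGAt x`: the route's `LeftRightFKG` with the fugacity `x_c` replaced by a parameter `x`
(sibling Disproof (a), verbatim).  `LeftRightFKGAt x_c ↔ LeftRightFKG` is `Iff.rfl` there;
`¬ LeftRightFKGAt 1 ↔ NotFKGAtOne` is `not_leftRightFKGAt_one_iff` below. [folklore] -/
def LeftRightFKGAt (x : ℝ) : Prop :=
  ∀ (δ : ℝ) (c a b a' b' : Site 2) (C : (zdGraph 2).Walk c c),
    let Ω : Set ℂ := {z | wind (fun t : ℝ => Set.IccExtend zero_le_one (C.toCurve (meshPoint δ)) t - z) ≠ 0}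
    let le : SAW.DomainSAW Ω δ a b → SAW.DomainSAW Ω δ a b → Prop := fun γ₁ γ₂ => ∀ z : ℂ,
      0 ≤ wind (fun t : ℝ => Set.IccExtend zero_le_one ((γ₁.walk.append γ₂.walk.reverse).toCurve (meshPoint δ)) t - z)
    0 < δ → a' ∈ C.support → b' ∈ C.support → (zdGraph 2).Adj a a' → (zdGraph 2).Adj b b' →
    ∀ A B : Set (SAW.DomainSAW Ω δ a b), (∀ γ₁ γ₂, le γ₁ γ₂ → γ₁ ∈ A → γ₂ ∈ A) →
      (∀ γ₁ γ₂, le γ₁ γ₂ → γ₁ ∈ B → γ₂ ∈ B) →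
      weightAt x Ω δ a b A * weightAt x Ω δ a b B ≤ weightAt x Ω δ a b Set.univ * weightAt x Ω δ a b (A ∩ B)

/-- The parametric negative `C⁺`: left–right PA fails on the whole fugacity ray `2x² + x⁴ > 1`. [folklore] -/
def CPlus : Prop := ∀ x : ℝ, 0 < x → 1 < 2 * x ^ 2 + x ^ 4 → ¬ LeftRightFKGAt x

/-- `Ω(C, δ)`: points of non-zero winding number of the mesh polyline of the closed walk `C`
(the crux's `let Ω`; Disproof §1 `dom`, verbatim). [folklore] -/
def dom (δ : ℝ) {c : Site 2} (C : (zdGraph 2).Walk c c) : Set ℂ :=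
  {z | wind (fun t : ℝ => IccExtend zero_le_one (C.toCurve (meshPoint δ)) t - z) ≠ 0}

/-- The crux's left–right preorder (its `let le`; Disproof §1 `lr`, verbatim). [folklore] -/
def lr {Ω : Set ℂ} {δ : ℝ} {a b : Site 2} (γ₁ γ₂ : SAW.DomainSAW Ω δ a b) : Prop :=
  ∀ z : ℂ, 0 ≤ wind (fun t : ℝ =>
    IccExtend zero_le_one ((γ₁.walk.append γ₂.walk.reverse).toCurve (meshPoint δ)) t - z)

/-! ### 2. The witness datum (Disproof §3, verbatim): `C = ∂[-1,3]²`, `a = (0,0)`, `b = (2,2)` -/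

/-- Lattice point `(x, y)` (`= bx x y` of `BoxDomain.lean`, definitionally). [folklore] -/
def P (x y : ℤ) : Site 2 := ![x, y]

/-- One explicit step of a lattice walk (pins the intermediate vertex for `decide`). [folklore] -/
abbrev stepTo {u w : Site 2} (v : Site 2) (h : (zdGraph 2).Adj u v) (p : (zdGraph 2).Walk v w) :
    (zdGraph 2).Walk u w :=
  SimpleGraph.Walk.cons h p

/-- The boundary `C₃` of the square `[-1,3]²`: a closed lattice walk of length 16 based at `(-1,-1)`,
counter-clockwise.  `Ω(C₃) = (-1,3)²`, `V(Ω(C₃)_1) = {0,1,2}²`. [folklore] -/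
def sq3 : (zdGraph 2).Walk (P (-1) (-1)) (P (-1) (-1)) :=
  stepTo (P 0 (-1)) (by decide) <| stepTo (P 1 (-1)) (by decide) <| stepTo (P 2 (-1)) (by decide) <|
  stepTo (P 3 (-1)) (by decide) <| stepTo (P 3 0) (by decide) <| stepTo (P 3 1) (by decide) <|
  stepTo (P 3 2) (by decide) <| stepTo (P 3 3) (by decide) <| stepTo (P 2 3) (by decide) <|
  stepTo (P 1 3) (by decide) <| stepTo (P 0 3) (by decide) <| stepTo (P (-1) 3) (by decide) <|
  stepTo (P (-1) 2) (by decide) <| stepTo (P (-1) 1) (by decide) <| stepTo (P (-1) 0) (by decide) <|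
  stepTo (P (-1) (-1)) (by decide) <| SimpleGraph.Walk.nil

/-- `(0,-1)` is a boundary vertex (below `a = (0,0)`). [folklore] -/
theorem mem_sq3_support_a' : P 0 (-1) ∈ sq3.support := by decide

/-- `(2,3)` is a boundary vertex (above `b = (2,2)`). [folklore] -/
theorem mem_sq3_support_b' : P 2 3 ∈ sq3.support := by decide

/-- `a ∼ a'`. [folklore] -/
theorem adj_a_a' : (zdGraph 2).Adj (P 0 0) (P 0 (-1)) := by decide

/-- `b ∼ b'`. [folklore] -/
theorem adj_b_b' : (zdGraph 2).Adj (P 2 2) (P 2 3) := by decide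

/-- The chords of the witness: SAWs of `Ω(C₃)_1` from `(0,0)` to `(2,2)`. [folklore] -/
abbrev Chord := SAW.DomainSAW (dom 1 sq3) 1 (P 0 0) (P 2 2)

/-- The corner event at `a`: `A₃ = {γ | 1 ≤ wcross 0 0 γ}` (= first step North). [folklore] -/
def A₃ : Set Chord := {γ | 1 ≤ wcross 0 0 γ.walk}

/-- The corner event at `b`: `B₃ = {γ | 1 ≤ wcross 1 1 γ}` (= last step East, from `(1,2)`). [folklore] -/
def B₃ : Set Chord := {γ | 1 ≤ wcross 1 1 γ.walk}

/-- **Crossing-count superlevel events are `≼`-up-closed — in EVERY domain at `δ = 1`** (Disproof §3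
`le_wcross_of_lr`, from the landed `wcross_le_of_wind_nonneg`; the height bound is read off the supports). [folklore] -/
theorem le_wcross_of_lr {Ω : Set ℂ} {a b : Site 2} (m k c : ℤ) (γ₁ γ₂ : SAW.DomainSAW Ω 1 a b)
    (h : lr γ₁ γ₂) (h₁ : c ≤ wcross m k γ₁.walk) : c ≤ wcross m k γ₂.walk := by
  have hG : ∀ x y, (discreteDomainGraph Ω 1).Adj x y → (zdGraph 2).Adj x y := fun x y hxy =>
    meshGraph_le_zdGraph Ω 1 (discreteDomainGraph_le_meshGraph Ω 1 hxy)
  classical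
  obtain ⟨Y, hY⟩ := Finset.exists_le
    (insert k (((γ₁.walk.support ++ γ₂.walk.support).map fun x : Site 2 => x 1).toFinset))
  have hkY : k ≤ Y := hY k (Finset.mem_insert_self _ _)
  have hs : ∀ x ∈ γ₁.walk.support ++ γ₂.walk.support, x 1 ≤ Y := fun x hx =>
    hY (x 1) (Finset.mem_insert_of_mem (List.mem_toFinset.2 (List.mem_map.2 ⟨x, hx, rfl⟩)))
  have key := wcross_le_of_wind_nonneg hG γ₁.walk γ₂.walk hkY
    (fun x hx => hs x (List.mem_append_left _ hx)) (fun x hx => hs x (List.mem_append_right _ hx))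
    (h (probeL m k))
  omega

/-- `A₃` is `≼`-up-closed (PROVED, no side condition). [folklore] -/
theorem isUp_A₃ : ∀ γ₁ γ₂ : Chord, lr γ₁ γ₂ → γ₁ ∈ A₃ → γ₂ ∈ A₃ :=
  fun γ₁ γ₂ h h₁ => le_wcross_of_lr 0 0 1 γ₁ γ₂ h h₁

/-- `B₃` is `≼`-up-closed (PROVED, no side condition). [folklore] -/
theorem isUp_B₃ : ∀ γ₁ γ₂ : Chord, lr γ₁ γ₂ → γ₁ ∈ B₃ → γ₂ ∈ B₃ :=
  fun γ₁ γ₂ h h₁ => le_wcross_of_lr 1 1 1 γ₁ γ₂ h h₁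

/-! ### 3. Kernel-decided data: the enumerated supports and the corner census -/

/-- The enumerated chord supports `(0,0) → (2,2)` of the box (landed `pathsFrom`/`nb₃`/`eqSite`). [folklore] -/
def chords₃ : List (List (Site 2)) := (pathsFrom eqSite nb₃ 8 (P 0 0) []).filter (endsAt eqSite (P 2 2))

/-- The signed crossing count read on a vertex list (so that `wcross m k w = supCross m k w.support`). [folklore] -/
def supCross (m k : ℤ) : List (Site 2) → ℤ
  | [] => 0
  | a :: l => pathCross m k a l

/-- `wcross` is a function of the support. [folklore] -/
theorem wcross_eq_supCross {G : SimpleGraph (Site 2)} {u v : Site 2} (m k : ℤ) (w : G.Walk u v) :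
    wcross m k w = supCross m k w.support := by
  cases w <;> rfl

/-- Boolean membership of a support in the class of `A₃`. [folklore] -/
def inA (s : List (Site 2)) : Bool := decide (1 ≤ supCross 0 0 s)

/-- Boolean membership of a support in the class of `B₃`. [folklore] -/
def inB (s : List (Site 2)) : Bool := decide (1 ≤ supCross 1 1 s)

/-- **The corner census, kernel-decided**: the enumeration is duplicate-free, has 12 supports with the
listed step counts, and the classes `A`, `B`, `A ∩ B` have step counts `{4,4,4,6,6,8}`, `{4,4,4,6,6,8}`,
`{4,4}` (in enumeration order). [folklore] -/
theorem corner_census :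
    chords₃.Nodup ∧
    (chords₃.map fun s => s.length - 1) = [8, 6, 4, 4, 6, 4, 4, 4, 6, 4, 6, 8] ∧
    ((chords₃.filter inA).map fun s => s.length - 1) = [4, 4, 6, 4, 6, 8] ∧
    ((chords₃.filter inB).map fun s => s.length - 1) = [8, 6, 6, 4, 4, 4] ∧
    ((chords₃.filter fun s => inA s && inB s).map fun s => s.length - 1) = [4, 4] := by
  decide

/-! ### 4. Proved algebra: class polynomials and the corner determinant -/

/-- Class polynomial of `A₃` (and of `B₃`). [folklore] -/
theorem sum_classA (x : ℝ) : ([4, 4, 6, 4, 6, 8].map fun k : ℕ => x ^ k).sum = 3 * x ^ 4 + 2 * x ^ 6 + x ^ 8 := by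
  simp only [List.map_cons, List.map_nil, List.sum_cons, List.sum_nil]; ring

/-- Class polynomial of `B₃`. [folklore] -/
theorem sum_classB (x : ℝ) : ([8, 6, 6, 4, 4, 4].map fun k : ℕ => x ^ k).sum = 3 * x ^ 4 + 2 * x ^ 6 + x ^ 8 := by
  simp only [List.map_cons, List.map_nil, List.sum_cons, List.sum_nil]; ring

/-- Class polynomial of `univ`. [folklore] -/
theorem sum_classU (x : ℝ) :
    ([8, 6, 4, 4, 6, 4, 4, 4, 6, 4, 6, 8].map fun k : ℕ => x ^ k).sum = 6 * x ^ 4 + 4 * x ^ 6 + 2 * x ^ 8 := by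
  simp only [List.map_cons, List.map_nil, List.sum_cons, List.sum_nil]; ring

/-- Class polynomial of `A₃ ∩ B₃`. [folklore] -/
theorem sum_classAB (x : ℝ) : ([4, 4].map fun k : ℕ => x ^ k).sum = 2 * x ^ 4 := by
  simp only [List.map_cons, List.map_nil, List.sum_cons, List.sum_nil]; ring

/-- **The corner determinant of the 3 × 3 box factorises.** [folklore] -/
theorem cornerDet₃ (x : ℝ) :
    (3 * x ^ 4 + 2 * x ^ 6 + x ^ 8) * (3 * x ^ 4 + 2 * x ^ 6 + x ^ 8) -
        (6 * x ^ 4 + 4 * x ^ 6 + 2 * x ^ 8) * (2 * x ^ 4) =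
      x ^ 8 * (2 * x ^ 2 + x ^ 4 - 1) * (3 + 2 * x ^ 2 + x ^ 4) := by
  ring

/-- … and is positive exactly on the ray `2x² + x⁴ > 1` (`x > (√2−1)^{1/2} = 0.6436…`); at `x = 1`:
`36 − 24 = 12`. [folklore] -/
theorem cornerDet₃_pos {x : ℝ} (hx : 0 < x) (h : 1 < 2 * x ^ 2 + x ^ 4) :
    (6 * x ^ 4 + 4 * x ^ 6 + 2 * x ^ 8) * (2 * x ^ 4) <
      (3 * x ^ 4 + 2 * x ^ 6 + x ^ 8) * (3 * x ^ 4 + 2 * x ^ 6 + x ^ 8) := by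
  have h8 : 0 < x ^ 8 := by positivity
  have h3 : 0 < 3 + 2 * x ^ 2 + x ^ 4 := by positivity
  have h1 : 0 < 2 * x ^ 2 + x ^ 4 - 1 := by linarith
  have : 0 < x ^ 8 * (2 * x ^ 2 + x ^ 4 - 1) * (3 + 2 * x ^ 2 + x ^ 4) := by positivity
  nlinarith [cornerDet₃ x]

/-! ### 5. The three stub statements -/

/-- STUB 1 statement — DOMAIN IDENTIFICATION: the discrete domain of `Ω(C₃)` at `δ = 1` is `ℤ²` induced on
the box `{0,1,2}²` (both directions: inside index `1` by `wind_poly_probeL`, boundary lattice points junk `0`,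
outside `0`; mesh edges between box sites lie in the open square; connected ⇒ largest component = all). [folklore] -/
def DomSq3 : Prop :=
  ∀ x y : Site 2, (discreteDomainGraph (dom 1 sq3) 1).Adj x y ↔
    (zdGraph 2).Adj x y ∧ x ∈ boxSites ![0, 0] ![2, 2] ∧ y ∈ boxSites ![0, 0] ![2, 2]

/-- STUB 2 statement — ENUMERATION IS FAITHFUL: `chords₃` lists exactly the supports of the chords
(completeness `support_mem_pathsFrom` + soundness `exists_walk_of_mem_pathsFrom` of the landed enumerator,
with `nb₃` complete/sound for `Ω(C₃)_1` by `DomSq3` and the length bound `≤ 8` on 9 vertices). [folklore] -/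
def ChordEnum : Prop :=
  (∀ γ : Chord, γ.walk.support ∈ chords₃) ∧ (∀ s ∈ chords₃, ∃ γ : Chord, γ.walk.support = s)

/-- STUB 3 statement — THE WEIGHTED CORNER CENSUS at every fugacity: the four weights of the witness are
the class polynomials (`weightAt` is a sum of Diracs; reindex over `chords₃` by `ChordEnum` +
`walk_eq_of_support_eq`, read the events through `wcross_eq_supCross`, and use `corner_census`). [folklore] -/
def CensusAt : Prop :=
  ∀ x : ℝ, 0 ≤ x →
    weightAt x (dom 1 sq3) 1 (P 0 0) (P 2 2) A₃ = ENNReal.ofReal (3 * x ^ 4 + 2 * x ^ 6 + x ^ 8) ∧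
    weightAt x (dom 1 sq3) 1 (P 0 0) (P 2 2) B₃ = ENNReal.ofReal (3 * x ^ 4 + 2 * x ^ 6 + x ^ 8) ∧
    weightAt x (dom 1 sq3) 1 (P 0 0) (P 2 2) univ = ENNReal.ofReal (6 * x ^ 4 + 4 * x ^ 6 + 2 * x ^ 8) ∧
    weightAt x (dom 1 sq3) 1 (P 0 0) (P 2 2) (A₃ ∩ B₃) = ENNReal.ofReal (2 * x ^ 4)

/-! ### 6. The registered stubs (the only `sorry`s of the file) -/

/-- STUB 1 (L; replay of the landed `BoxDomain.lean` + `BoxMesh.lean` — the `5 × 4` box — at `3 × 3`).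
HARDEST (plane topology of `wind` for a concrete polygon; ~450 lines of precedent to adapt). [folklore] -/
theorem stub_domSq3 : DomSq3 := by
  sorry

/-- STUB 2 (M; graph combinatorics over the landed `pathsFrom` API, given STUB 1). [folklore] -/
theorem stub_chordEnum : DomSq3 → ChordEnum := by
  sorry

/-- STUB 3 (M; measure evaluation `Measure.sum` of Diracs ↦ list sums over `chords₃`, given STUB 2). [folklore] -/
theorem stub_censusAt : ChordEnum → CensusAt := by
  sorry

/-! ### Name-keyed aliases of the stub statements (hypotheses of the composition) -/
namespace Registered

/-- Alias keyed by the registered stub name. [folklore] -/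
abbrev stub_domSq3 : Prop := DomSq3
/-- Alias keyed by the registered stub name. [folklore] -/
abbrev stub_chordEnum : Prop := DomSq3 → ChordEnum
/-- Alias keyed by the registered stub name. [folklore] -/
abbrev stub_censusAt : Prop := ChordEnum → CensusAt

end Registered

/-! ### 7. The sorry-free part: transfer `CensusAt → C⁺ → NotFKGAtOne` and the composition -/

/-- Products of `ofReal`s compare like the real products (nonnegative factors). [folklore] -/
theorem ofReal_mul_lt {p q r s : ℝ} (hp : 0 ≤ p) (hr : 0 ≤ r) (hs : 0 ≤ s) (h : r * s < p * q) :
    ENNReal.ofReal r * ENNReal.ofReal s < ENNReal.ofReal p * ENNReal.ofReal q := by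
  rw [← ENNReal.ofReal_mul hr, ← ENNReal.ofReal_mul hp]
  exact (ENNReal.ofReal_lt_ofReal_iff (lt_of_le_of_lt (mul_nonneg hr hs) h)).2 h

/-- **TRANSFER (proved): the weighted census refutes left–right PA on the whole ray `2x² + x⁴ > 1`.**
Specialise `LeftRightFKGAt x` to the witness datum (`δ = 1`, `C₃`, `a`, `b`, `a'`, `b'` checked by `decide`),
feed it the up-closed corner events (`isUp_A₃`, `isUp_B₃`), rewrite the four weights by `CensusAt`, and
contradict `cornerDet₃_pos`. [folklore] -/
theorem cPlus_of_censusAt (hc : CensusAt) : CPlus := by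
  intro x hx hray hPA
  obtain ⟨cA, cB, cU, cAB⟩ := hc x hx.le
  have key : weightAt x (dom 1 sq3) 1 (P 0 0) (P 2 2) A₃ * weightAt x (dom 1 sq3) 1 (P 0 0) (P 2 2) B₃ ≤
      weightAt x (dom 1 sq3) 1 (P 0 0) (P 2 2) univ * weightAt x (dom 1 sq3) 1 (P 0 0) (P 2 2) (A₃ ∩ B₃) :=
    hPA 1 (P (-1) (-1)) (P 0 0) (P 2 2) (P 0 (-1)) (P 2 3) sq3 one_pos mem_sq3_support_a'
      mem_sq3_support_b' adj_a_a' adj_b_b' A₃ B₃ isUp_A₃ isUp_B₃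
  rw [cA, cB, cU, cAB] at key
  have hp : (0 : ℝ) ≤ 3 * x ^ 4 + 2 * x ^ 6 + x ^ 8 := by positivity
  have hr : (0 : ℝ) ≤ 6 * x ^ 4 + 4 * x ^ 6 + 2 * x ^ 8 := by positivity
  have hs : (0 : ℝ) ≤ 2 * x ^ 4 := by positivity
  exact absurd key (not_le.2 (ofReal_mul_lt hp hr hs (cornerDet₃_pos hx hray)))

/-- TRANSFER, logical half (proved): `¬ LeftRightFKGAt 1` IS the crux, by `weightAt 1 = Measure.count`
(stated as an `Iff` so that exactly one theorem of the file — `NotFKGAtOne_of` — concludes the crux by name). [folklore] -/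
theorem not_leftRightFKGAt_one_iff :
    ¬ LeftRightFKGAt 1 ↔ Summit.CriticalPhenomena.SAWScalingLimit.Theses.SAWLeftRightFKG.NotFKGAtOne := by
  constructor
  · intro h hall
    apply h
    intro δ c a b a' b' C Ω le hδ ha hb haa hbb A B hA hB
    simpa only [weightAt_one] using hall δ c a b a' b' C hδ ha hb haa hbb A B hA hB
  · intro h hPA
    apply h
    intro δ c a b a' b' C Ω le hδ ha hb haa hbb A B hA hB
    simpa only [weightAt_one] using hPA δ c a b a' b' C hδ ha hb haa hbb A B hA hB

/-- **The composition (kernel-checked, no `sorry`)**: the three stubs imply the crux `NotFKGAtOne` BY NAME —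
STUB 1 identifies the discrete domain, STUB 2 makes the kernel census an enumeration of the chords, STUB 3
evaluates the four weights at every fugacity; `cPlus_of_censusAt` is the parametric negative `C⁺`, taken at
its `x = 1` point (`2 + 1 = 3 > 1`) and read as the crux through `not_leftRightFKGAt_one_iff`. [folklore] -/
theorem NotFKGAtOne_of (h1 : Registered.stub_domSq3) (h2 : Registered.stub_chordEnum)
    (h3 : Registered.stub_censusAt) :
    Summit.CriticalPhenomena.SAWScalingLimit.Theses.SAWLeftRightFKG.NotFKGAtOne :=
  not_leftRightFKGAt_one_iff.1 (cPlus_of_censusAt (h3 (h2 h1)) 1 one_pos (by norm_num))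

/-- The parametric by-product for the sibling crux `LeftRightFKG` (stmt-CriticalPhenomena-11232, Disproof (a)/E5:
first rung `x ≥ .6436` of `not_leftRightFKGAt`), from the same three stubs. [folklore] -/
theorem cPlus_of (h1 : Registered.stub_domSq3) (h2 : Registered.stub_chordEnum)
    (h3 : Registered.stub_censusAt) : CPlus :=
  cPlus_of_censusAt (h3 (h2 h1))

/-- Wiring check: the registered stubs feed `NotFKGAtOne_of` as stated. [folklore] -/
example : Summit.CriticalPhenomena.SAWScalingLimit.Theses.SAWLeftRightFKG.NotFKGAtOne :=
  NotFKGAtOne_of stub_domSq3 stub_chordEnum stub_censusAt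

end Summit.CriticalPhenomena.SAWScalingLimit.Cruxes.NotFKGAtOne.CornerDeterminantTransfer

end
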